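import Literature.AnabelianGeometry.SemiGraphs.TemperedAnabelian
import HarnessLib

/-!
# Profinite completions: a COMPACT group is its own profinite completion; restriction to a compact
# subgroup (the «ιYdd» input of [EtTh] Rmk. 1.6.4, spec v2)

Mochizuki, *Semi-graphs of anabelioids*, Publ. RIMS **42** (2006) [SemiAnbd], §6 p. 69 ("we shall
denote the profinite completion of a group by means of a `∧`") [cite: MochizukiSemiAnbd2006, §6 p.69];
used for Mochizuki, *The étale theta function …*, Publ. RIMS **45** (2009) [EtTh], Remark 1.6.4 p. 252
("determines, by profinite completion, a set of classes … `∈ H¹(Π_{Ÿ^∧}, Δ_Θ)`")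
[cite: MochizukiEtTh2009, Rmk 1.6.4 p.252] through the Θ-quotient route of the abc-iut spec of record
«RMK164-PROFINITE-TWIN v2» (L2-lead R1227): the theta classes arise from the Θ-quotient
(Prop. 1.5 (iii) p. 23), where the image `(Π^tp_Ÿ)^Θ` of `Π^tp_Ÿ` is ALREADY COMPACT, so its map to
(the closure of its image in) the profinite Θ-quotient is a profinite completion for free — no
cofinality clause (cf. `Discharge/Sec1Rmk164ProfiniteCompletionRestrictCofinal.lean`, `…RestrictNoGo.lean`).

PROOF-ONLY (abc-iut cell, prover abc-iut-f-128 gen 8, row «RMK164-IOTA-YDD-THETA» file 1/2; no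
definitions, no facts): CLASSICAL topological group theory over the interface `IsProfiniteCompletion`
(`TemperedAnabelian.lean`):
* `of_compactSpace_of_injective` — a continuous INJECTIVE homomorphism with DENSE range from a COMPACT
  group to a Hausdorff totally disconnected group is a profinite completion (it is onto, closed, hence
  a topological isomorphism; an open normal finite-index `U` is cut out by its own image);
* `topologicalClosure_map_eq_of_isCompact` — for a compact subgroup `K`, `closure ι(K) = ι(K)`;
* `restrict_of_isCompact` / `restrict_of_isCompact'` — for ANY continuous homomorphism `ι : F → F̂`
  into a Hausdorff totally disconnected group, injective on a subgroup `K ≤ F` with `(K : Set F)`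
  compact, a continuous `ιK : K → closure ι(K)` agreeing with `ι` is a profinite completion.
Mathlib only.  Nothing here bears on [IUTchIII] Cor. 3.12; the [EtTh] instance is file 2/2.
-/

noncomputable section

namespace Literature.AnabelianGeometry.SemiGraphs

namespace IsProfiniteCompletion

open Topology

universe u v

variable {F : Type u} {Fhat : Type v} [Group F] [TopologicalSpace F] [IsTopologicalGroup F]
  [Group Fhat] [TopologicalSpace Fhat] [IsTopologicalGroup Fhat]

/-- **A compact group is its own profinite completion.**  A continuous injective homomorphism
`ι : F → F̂` with dense range from a COMPACT topological group to a Hausdorff totally disconnected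
topological group is a profinite completion: its range is compact, hence closed, hence everything;
`ι` is a closed continuous bijection; an open normal finite-index `U ⊴ F` is cut out by the open normal
subgroup `ι(U)`. [cite: MochizukiSemiAnbd2006, §6 p.69] -/
theorem of_compactSpace_of_injective [CompactSpace F] [T2Space Fhat] [TotallyDisconnectedSpace Fhat]
    (ι : F →ₜ* Fhat) (hinj : Function.Injective ι) (hd : DenseRange ι) : IsProfiniteCompletion ι := by
  classical
  -- `ι` is onto
  have hrange : Set.range ι = Set.univ := by
    rw [← hd.closure_range]
    exact ((isCompact_range ι.continuous).isClosed.closure_eq).symm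
  have hsurj : Function.Surjective ι := Set.range_eq_univ.mp hrange
  have hclosed : IsClosedMap ι := ι.continuous.isClosedMap
  haveI : CompactSpace Fhat := by
    refine isCompact_univ_iff.mp ?_
    rw [← hrange, ← Set.image_univ]
    exact isCompact_univ.image ι.continuous
  refine
    { compactSpace := inferInstance
      t2Space := inferInstance
      totallyDisconnectedSpace := inferInstance
      denseRange := hd
      comap_surjective := ?_
      isOpen_comap := fun V => ?_ }
  · intro U hU
    haveI := hU
    -- `ι(U)` is closed of finite index, hence open, and normal
    have hUcl : IsClosed ((U.toSubgroup.map ι.toMonoidHom : Subgroup Fhat) : Set Fhat) := by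
      rw [Subgroup.coe_map]
      exact hclosed _ U.toOpenSubgroup.isClosed
    haveI hUfi : (U.toSubgroup.map ι.toMonoidHom).FiniteIndex := by
      refine ⟨?_⟩
      rw [Subgroup.index_map_eq _ hsurj (by
        rw [(MonoidHom.ker_eq_bot_iff ι.toMonoidHom).mpr hinj]
        exact bot_le)]
      exact hU.index_ne_zero
    have hUo : IsOpen ((U.toSubgroup.map ι.toMonoidHom : Subgroup Fhat) : Set Fhat) :=
      Subgroup.isOpen_of_isClosed_of_finiteIndex _ hUcl
    have hUn : (U.toSubgroup.map ι.toMonoidHom).Normal := U.isNormal'.map ι.toMonoidHom hsurj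
    refine ⟨{ toSubgroup := U.toSubgroup.map ι.toMonoidHom, isOpen' := hUo, isNormal' := hUn }, ?_⟩
    exact (Subgroup.comap_map_eq_self_of_injective hinj _).symm
  · exact V.toOpenSubgroup.isOpen.preimage ι.continuous

omit [IsTopologicalGroup F] in
/-- For a subgroup `K ≤ F` with compact underlying set and a continuous `ι` into a Hausdorff group, the
closure of `ι(K)` is `ι(K)` itself (as subgroups of `F̂`) — the case in which "the `∧` denotes profinite
completion, or, equivalently, closure" ([SemiAnbd] §6) needs no completion at all.
[cite: MochizukiSemiAnbd2006, §6 p.69] -/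
theorem topologicalClosure_map_eq_of_isCompact [T2Space Fhat] (ι : F →ₜ* Fhat) (K : Subgroup F)
    (hK : IsCompact (K : Set F)) :
    (K.map ι.toMonoidHom).topologicalClosure = K.map ι.toMonoidHom := by
  apply SetLike.coe_injective
  rw [Subgroup.topologicalClosure_coe, Subgroup.coe_map]
  exact ((hK.image ι.continuous).isClosed).closure_eq

omit [IsTopologicalGroup F] in
/-- `ι(K)` is dense in its closure, read inside the closure. [folklore] -/
private theorem denseRange_corestrict (ι : F →ₜ* Fhat) (K : Subgroup F) (W : Subgroup Fhat)
    (hW : W = (K.map ι.toMonoidHom).topologicalClosure) (ιK : K →ₜ* W)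
    (hιK : ∀ k : K, ((ιK k : W) : Fhat) = ι (k : F)) : DenseRange ιK := by
  have hr : Set.range ιK = (Subtype.val : W → Fhat) ⁻¹' (ι '' (K : Set F)) := by
    ext w
    constructor
    · rintro ⟨k, rfl⟩
      exact ⟨k, k.2, (hιK k).symm⟩
    · rintro ⟨x, hx, hxw⟩
      refine ⟨⟨x, hx⟩, Subtype.ext ?_⟩
      rw [hιK]; exact hxw
  rw [DenseRange, hr, Subtype.dense_iff]
  intro w hw
  have hWset : (W : Set Fhat) = closure (ι '' (K : Set F)) := by
    rw [hW, Subgroup.topologicalClosure_coe, Subgroup.coe_map]; rfl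
  have hw' : w ∈ closure (ι '' (K : Set F)) := by rw [← hWset]; exact hw
  refine closure_mono ?_ hw'
  rintro _ ⟨x, hx, rfl⟩
  have hxW : ι x ∈ W := by rw [hW]; exact Subgroup.le_topologicalClosure _ ⟨x, hx, rfl⟩
  exact ⟨⟨ι x, hxW⟩, ⟨x, hx, rfl⟩, rfl⟩

/-- **Restriction to a compact subgroup.**  Let `ι : F → F̂` be ANY continuous homomorphism into a
Hausdorff totally disconnected group, `K ≤ F` a subgroup with `(K : Set F)` compact on which `ι` is
injective, `W` the closure of `ι(K)` in `F̂` (`= ι(K)`), and `ιK : K → W` a continuous homomorphism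
agreeing with `ι`.  Then `ιK` is a profinite completion of `K` — the input «`IsProfiniteCompletion ιYdd`»
of the RMK164 spec v2 at `K = (Π^tp_Ÿ)^Θ` (compact), with NO cofinality clause.
[cite: MochizukiSemiAnbd2006, §6 p.69] [cite: MochizukiEtTh2009, Rmk 1.6.4 p.252] -/
theorem restrict_of_isCompact [T2Space Fhat] [TotallyDisconnectedSpace Fhat] (ι : F →ₜ* Fhat)
    (K : Subgroup F) (hK : IsCompact (K : Set F)) (hinj : Set.InjOn ι (K : Set F))
    (W : Subgroup Fhat) (hW : W = (K.map ι.toMonoidHom).topologicalClosure) (ιK : K →ₜ* W)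
    (hιK : ∀ k : K, ((ιK k : W) : Fhat) = ι (k : F)) : IsProfiniteCompletion ιK := by
  haveI : CompactSpace K := isCompact_iff_compactSpace.mp hK
  have hinjK : Function.Injective ιK := by
    intro k k' hkk'
    have h1 : ι (k : F) = ι (k' : F) := by
      rw [← hιK, ← hιK, hkk']
    exact Subtype.ext (hinj k.2 k'.2 h1)
  exact of_compactSpace_of_injective ιK hinjK (denseRange_corestrict ι K W hW ιK hιK)

/-- `restrict_of_isCompact` with the target given literally as `(K.map ι).topologicalClosure`.
[cite: MochizukiSemiAnbd2006, §6 p.69] -/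
theorem restrict_of_isCompact' [T2Space Fhat] [TotallyDisconnectedSpace Fhat] (ι : F →ₜ* Fhat)
    (K : Subgroup F) (hK : IsCompact (K : Set F)) (hinj : Set.InjOn ι (K : Set F))
    (ιK : K →ₜ* ↥((K.map ι.toMonoidHom).topologicalClosure))
    (hιK : ∀ k : K, ((ιK k : ↥((K.map ι.toMonoidHom).topologicalClosure)) : Fhat) = ι (k : F)) :
    IsProfiniteCompletion ιK :=
  restrict_of_isCompact ι K hK hinj _ rfl ιK hιK

/-- `restrict_of_isCompact` with the target given as the IMAGE `K.map ι` (which equals the closure for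
compact `K`, `topologicalClosure_map_eq_of_isCompact`). [cite: MochizukiSemiAnbd2006, §6 p.69] -/
theorem restrict_of_isCompact_map [T2Space Fhat] [TotallyDisconnectedSpace Fhat] (ι : F →ₜ* Fhat)
    (K : Subgroup F) (hK : IsCompact (K : Set F)) (hinj : Set.InjOn ι (K : Set F))
    (ιK : K →ₜ* ↥(K.map ι.toMonoidHom))
    (hιK : ∀ k : K, ((ιK k : ↥(K.map ι.toMonoidHom)) : Fhat) = ι (k : F)) :
    IsProfiniteCompletion ιK :=
  restrict_of_isCompact ι K hK hinj _ (topologicalClosure_map_eq_of_isCompact ι K hK).symm ιK hιK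

end IsProfiniteCompletion

end Literature.AnabelianGeometry.SemiGraphs

end
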